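import Literature.Computability.AlgebraicComplexity.KoszulBorderRank
import Literature.Computability.AlgebraicComplexity.LaserMethodBigCW
import Literature.Computability.AlgebraicComplexity.BigCwFourthOmega
import HarnessLib

/-!
# `bR(⟨n,n,n⟩) ≥ 3n²/2` (Strassen; BCS 1997, Cor. (19.14)), `bR(⟨n,n,n⟩) ≥ 2n² − n` (Landsberg–Ottaviani 2015), and the three smallest cubic instances of the Coppersmith–Winograd barrier for the BORDER rank: `2^ω < bR(⟨2,2,2⟩)`, `3^ω < bR(⟨3,3,3⟩)`, `4^ω < bR(⟨4,4,4⟩)` — proved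

Topic `Literature/Computability/AlgebraicComplexity`. Theorems only (no definitions, no named facts).

* `le_rank_koszulFlattening_commutatorProj_matMulTensor` — for `n ≥ 2` and Landsberg's commutator
  projection `Φ : K^{n×n} → K³` (`commutatorProj`, coordinate matrices `Id`, cyclic shift,
  `diag(0,…,n−1)`), the `p = 1` Koszul flattening of `⟨n,n,n⟩` has rank `≥ 3n²` in characteristic
  `0`: it is `M̃(Φ) ⊗ Id_n` (`koszulFlattening_matMul_submatrix`) with `M̃(Φ)` injective
  (`matMulKoszulMatrix_commutatorProj_injective`, Landsberg 2014, §4), so a `3n² × 3n²` minor equals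
  `det(M̃)^n ≠ 0`.
* `three_mul_sq_le_two_mul_algBorderRank_matMulTensor` — **`3n² ≤ 2·bR(⟨n,n,n⟩)`**, i.e.
  `bR(⟨n,n,n⟩) ≥ ⌈3n²/2⌉`, over every field of characteristic `0` (BCS 1997, Cor. (19.14):
  "`R̲(k^{m×m}) ≥ 3m²/2` for `m ≥ 2`", there deduced from Strassen's Thm. (19.12)
  `R̲(t) ≥ n + ½ rk(BA⁻¹C − CA⁻¹B)`; here from the Koszul form of the same commutator and
  Landsberg–Ottaviani 2015, Thm. 2.1 for the algebraic border rank `algBorderRank`,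
  `LandsbergOttaviani2015_thm21_algBorderRank`: `rank K_Φ(t) ≤ C(2p,p)·bR(t)`). Instances
  `six_le_algBorderRank_matMulTensor_two` (`bR(⟨2,2,2⟩) ≥ 6`; BCS Problem 15.1: "either 6 or 7"),
  `fourteen_le_algBorderRank_matMulTensor_three` (`bR(⟨3,3,3⟩) ≥ 14`).
* `le_rank_koszulFlattening_vandermondeProj_matMulTensor`,
  `LandsbergOttaviani2015_algBorderRank_matMulTensor` — **`(2n−1)·n ≤ bR(⟨n,n,n⟩)`** for `n ≥ 1` in
  characteristic `0` (Landsberg 2017, Thm. 2.5.2.6 [LO15]: "`R̲(M_⟨m,n,l⟩) ≥ nl(n+m−1)/m` … in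
  particular `R̲(M_⟨n⟩) ≥ 2n² − n`"): the `p = n−1` Koszul flattening after the Vandermonde form of the
  LO projection is `M̃ ⊗ Id_n` with `M̃` injective (`matMulKoszulMatrix_vandermondeProj_injective`, in the
  tree), so `C(2n−1,n)·n² ≤ rank ≤ C(2n−2,n−1)·bR`, and `C(2n−1,n)·n = (2n−1)·C(2n−2,n−1)`. Instances
  `fifteen_le_algBorderRank_matMulTensor_three`, `twentyeight_le_algBorderRank_matMulTensor_four`.
* `eight_rpow_omega_div_three_lt_six`, `twentyseven_rpow_omega_div_three_lt_fourteen`,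
  `sixtyfour_rpow_omega_div_three_lt_twentyseven` (the last from `LeGall2014_cw4 : ω < 2.373`:
  `64^{ω/3} < 64^{19/24} < 27`, `2^{114} < 3^{72}`) — numerics
  from the tree's `BCS1997_cor1545_field : ω < 2.39` (laser method on `CW_6`, every field):
  `8^{ω/3} < 8^{4/5} < 6` (`4096 < 7776`) and `27^{ω/3} < 27^{4/5} < 14` (`531441 < 537824`).
* `rpow_omega_div_three_lt_algBorderRank_matMulTensor_two/three/four` — **`2^ω < bR(⟨2,2,2⟩)`,
  `3^ω < bR(⟨3,3,3⟩)`, `4^ω < bR(⟨4,4,4⟩)` in characteristic `0`**: the instances `n = 2, 3, 4` of the border-rank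
  strict asymptotic sum inequality `(kmn)^{ω/3} < bR(⟨k,m,n⟩)` attributed to Coppersmith–Winograd
  1982 (BCS 1997, §15.13 Notes, p. 455; the tree's named fact `CoppersmithWinograd1982_strictASI` /
  `InfimumNotMinimumBarrier` over `ℂ`, `Literature/Barriers/MatrixMultiplication/`), obtained NOT by
  the Coppersmith–Winograd mechanism but numerically, from a lower bound on the border rank and an
  upper bound on `ω`: no approximate bilinear algorithm for `2×2` or `3×3` matrix multiplication
  (Strassen's, Laderman's, or any border-rank improvement of them) certifies its own exponent bound
  `ω ≤ log_n bR(⟨n,n,n⟩)` with equality (nor for `4×4`). For `n ≥ 5` this route ends: the known lower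
  bounds on `bR(⟨n,n,n⟩)` (`2n² − n`, or `2n² − ⌈log₂ n⌉ − 1`) are below `n^{2.373}`.

Sources. P. Bürgisser, M. Clausen, M. A. Shokrollahi, *Algebraic Complexity Theory*, Springer 1997
(held), Thm. (19.12) (Strassen) and Cor. (19.14), p. 515 of the held PDF; §15.13 Notes p. 455;
Cor. (15.45) [BurgisserClausenShokrollahi1997]. J. M. Landsberg, *New lower bounds for the rank of
matrix multiplication*, SIAM J. Comput. 43 (2014), §4 (`p = 1`) [Landsberg2014]. J. M. Landsberg,
G. Ottaviani, *New lower bounds for the border rank of matrix multiplication*, Theory Comput. 11 (2015),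
Thm. 2.1 and §3 [LandsbergOttaviani2015]. J. M. Landsberg, *Geometry and Complexity Theory*, CUP 2017 (held),
§2.5.2, Thm. 2.5.2.6 (p. 42 of the held PDF) [Landsberg2017]. F. Le Gall, *Powers of tensors and fast matrix
multiplication*, ISSAC 2014, §6.3 (`ω < 2.3728639`) [LeGall2014].
-/

noncomputable section

open scoped BigOperators

namespace Literature.Computability.AlgebraicComplexity

universe u

/-! ## `rank K_Φ(⟨n,n,n⟩) = 3n²` for the commutator projection, and `3n² ≤ 2 bR(⟨n,n,n⟩)` -/

section ThreeHalves

variable (K : Type u) [Field K] [CharZero K]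

/-- For the commutator projection `Φ : K^{n×n} → K³` (coordinate matrices `Id`, cyclic shift,
`diag(0,…,n−1)`; Landsberg 2014, §4, case `p = 1`) and `n ≥ 2`, the `p = 1` Koszul flattening of
`⟨n,n,n⟩` has rank `≥ 3n²`: it is `M̃(Φ) ⊗ Id_n` (`koszulFlattening_matMul_submatrix`) with `M̃(Φ)`
injective (`matMulKoszulMatrix_commutatorProj_injective`), so the corresponding `3n² × 3n²` minor is
`det(M̃)^n ≠ 0` (char. `0`). [cite: Landsberg2014, §4 (case p = 1)] -/
theorem le_rank_koszulFlattening_commutatorProj_matMulTensor (n : ℕ) (hn : 2 ≤ n) :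
    3 * n * n ≤ (koszulFlattening 1 (commutatorProj K n) (matMulTensor K n n n)).rank := by
  classical
  have hcard : Fintype.card (PSub (2 * 1 + 1) (1 + 1) × Fin n) =
      Fintype.card (PSub (2 * 1 + 1) 1 × Fin n) := by
    simp only [Fintype.card_prod, card_PSub, Fintype.card_fin]
    rfl
  obtain ⟨ε, hε⟩ := exists_det_submatrix_ne_zero_of_injective _ hcard
    (matMulKoszulMatrix_commutatorProj_injective K n hn)
  have hM := koszulFlattening_matMul_submatrix n n 1 (commutatorProj K n)
    (ι := PSub (2 * 1 + 1) (1 + 1) × Fin n) id ε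
  set X := (PSub (2 * 1 + 1) (1 + 1) × Fin n) × Fin n with hX
  set rowf : X → PSub (2 * 1 + 1) (1 + 1) × (Fin n × Fin n) :=
    fun x => ((id x.1).1, (x.2, (id x.1).2)) with hrowf
  set colf : X → PSub (2 * 1 + 1) 1 × (Fin n × Fin n) :=
    fun x => ((ε x.1).1, ((ε x.1).2, x.2)) with hcolf
  have hdet : ((koszulFlattening 1 (commutatorProj K n) (matMulTensor K n n n)).submatrix
      rowf colf).det ≠ 0 := by
    rw [hrowf, hcolf, hM, Matrix.det_blockDiagonal]
    exact Finset.prod_ne_zero_iff.2 fun _ _ => hε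
  -- index by `Fin (card X)` and read off the rank bound
  let e : Fin (Fintype.card X) ≃ X := (Fintype.equivFin X).symm
  have hdet' : ((koszulFlattening 1 (commutatorProj K n) (matMulTensor K n n n)).submatrix
      (rowf ∘ e) (colf ∘ e)).det ≠ 0 := by
    rw [show (koszulFlattening 1 (commutatorProj K n) (matMulTensor K n n n)).submatrix
        (rowf ∘ e) (colf ∘ e) =
        ((koszulFlattening 1 (commutatorProj K n) (matMulTensor K n n n)).submatrix rowf colf).submatrix
          e e from rfl, Matrix.det_submatrix_equiv_self]
    exact hdet
  have hk := Matrix.le_rank_of_isUnit_det_submatrix _ (rowf ∘ e) (colf ∘ e)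
    (isUnit_iff_ne_zero.2 hdet')
  have hcardX : Fintype.card X = 3 * n * n := by
    simp only [X, Fintype.card_prod, card_PSub, Fintype.card_fin]
    rfl
  rwa [hcardX] at hk

/-- **`3n² ≤ 2 · bR(⟨n,n,n⟩)`** for `n ≥ 2` over a field of characteristic `0`, i.e.
`bR(⟨n,n,n⟩) ≥ ⌈3n²/2⌉` — the border-rank lower bound of Strassen 1983 as in
Bürgisser–Clausen–Shokrollahi 1997, Cor. (19.14) ("`R̲(k^{m×m}) ≥ 3m²/2` for `m ≥ 2`", from
Thm. (19.12), `R̲(t) ≥ n + ½ rk(BA⁻¹C − CA⁻¹B)`), obtained here through the Koszul-flattening form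
of the same commutator (Landsberg 2014, §4, `p = 1`; Landsberg–Ottaviani 2015, Thm. 2.1 for the
algebraic border rank, `LandsbergOttaviani2015_thm21_algBorderRank`: `rank K_Φ(t) ≤ C(2,1)·bR(t)`).
[cite: BurgisserClausenShokrollahi1997, Cor. (19.14) (p. 515)] [cite: LandsbergOttaviani2015, Thm 2.1]
[cite: Landsberg2014, §4 (case p = 1)] -/
theorem three_mul_sq_le_two_mul_algBorderRank_matMulTensor (n : ℕ) (hn : 2 ≤ n) :
    3 * n * n ≤ 2 * algBorderRank (matMulTensor K n n n) := by
  have h1 := le_rank_koszulFlattening_commutatorProj_matMulTensor K n hn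
  have h2 := LandsbergOttaviani2015_thm21_algBorderRank 1 (commutatorProj K n) (matMulTensor K n n n)
  have h3 : (2 * 1).choose 1 = 2 := by decide
  rw [h3] at h2
  exact h1.trans h2

/-- `bR(⟨2,2,2⟩) ≥ 6` in characteristic `0` (BCS 1997, Cor. (19.14) with `m = 2`; cf. Problem 15.1
there: "this border rank is either 6 or 7"). [cite: BurgisserClausenShokrollahi1997, Cor. (19.14) (p. 515)] -/
theorem six_le_algBorderRank_matMulTensor_two : 6 ≤ algBorderRank (matMulTensor K 2 2 2) := by
  have := three_mul_sq_le_two_mul_algBorderRank_matMulTensor K 2 le_rfl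
  omega

/-- `bR(⟨3,3,3⟩) ≥ 14` in characteristic `0` (BCS 1997, Cor. (19.14) with `m = 3`: `≥ 27/2`).
[cite: BurgisserClausenShokrollahi1997, Cor. (19.14) (p. 515)] -/
theorem fourteen_le_algBorderRank_matMulTensor_three : 14 ≤ algBorderRank (matMulTensor K 3 3 3) := by
  have := three_mul_sq_le_two_mul_algBorderRank_matMulTensor K 3 (by norm_num)
  omega

end ThreeHalves


/-! ## Landsberg–Ottaviani: `bR(⟨n,n,n⟩) ≥ 2n² − n` -/

section LandsbergOttaviani

variable (K : Type u) [Field K] [CharZero K]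

/-- For the Vandermonde form of the Landsberg–Ottaviani projection `Φ : K^{n×n} → K^{2n−1}`
(`vandermondeProj (n-1)`), the `p = n − 1` Koszul flattening of `⟨n,n,n⟩` has rank
`≥ C(2n−1, n)·n²` in characteristic `0`: it is `M̃(Φ) ⊗ Id_n` with `M̃(Φ)` injective
(`matMulKoszulMatrix_vandermondeProj_injective`, Landsberg 2017, Thm. 2.5.2.6, first proof), so the
corresponding maximal minor is `det(M̃)^n ≠ 0`. Stated with `n = p + 1`.
[cite: Landsberg2017, §2.5.2, Thm. 2.5.2.6 (proof)] [cite: LandsbergOttaviani2015, §3] -/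
theorem le_rank_koszulFlattening_vandermondeProj_matMulTensor (p : ℕ) :
    (2 * p + 1).choose (p + 1) * (p + 1) * (p + 1) ≤
      (koszulFlattening p (vandermondeProj K p) (matMulTensor K (p + 1) (p + 1) (p + 1))).rank := by
  classical
  have hcard : Fintype.card (PSub (2 * p + 1) (p + 1) × Fin (p + 1)) =
      Fintype.card (PSub (2 * p + 1) p × Fin (p + 1)) := by
    simp only [Fintype.card_prod, card_PSub, Fintype.card_fin, Nat.choose_symm_half]
  obtain ⟨ε, hε⟩ := exists_det_submatrix_ne_zero_of_injective _ hcard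
    (matMulKoszulMatrix_vandermondeProj_injective K p)
  have hM := koszulFlattening_matMul_submatrix (p + 1) (p + 1) p (vandermondeProj K p)
    (ι := PSub (2 * p + 1) (p + 1) × Fin (p + 1)) id ε
  set X := (PSub (2 * p + 1) (p + 1) × Fin (p + 1)) × Fin (p + 1) with hX
  set rowf : X → PSub (2 * p + 1) (p + 1) × (Fin (p + 1) × Fin (p + 1)) :=
    fun x => ((id x.1).1, (x.2, (id x.1).2)) with hrowf
  set colf : X → PSub (2 * p + 1) p × (Fin (p + 1) × Fin (p + 1)) :=
    fun x => ((ε x.1).1, ((ε x.1).2, x.2)) with hcolf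
  set M := koszulFlattening p (vandermondeProj K p) (matMulTensor K (p + 1) (p + 1) (p + 1)) with hMdef
  have hdet : (M.submatrix rowf colf).det ≠ 0 := by
    rw [hMdef, hrowf, hcolf, hM, Matrix.det_blockDiagonal]
    exact Finset.prod_ne_zero_iff.2 fun _ _ => hε
  let e : Fin (Fintype.card X) ≃ X := (Fintype.equivFin X).symm
  have hdet' : (M.submatrix (rowf ∘ e) (colf ∘ e)).det ≠ 0 := by
    rw [show M.submatrix (rowf ∘ e) (colf ∘ e) = (M.submatrix rowf colf).submatrix e e from rfl,
      Matrix.det_submatrix_equiv_self]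
    exact hdet
  have hk := Matrix.le_rank_of_isUnit_det_submatrix _ (rowf ∘ e) (colf ∘ e)
    (isUnit_iff_ne_zero.2 hdet')
  have hcardX : Fintype.card X = (2 * p + 1).choose (p + 1) * (p + 1) * (p + 1) := by
    simp only [X, Fintype.card_prod, card_PSub, Fintype.card_fin]
  rwa [hcardX] at hk

/-- **Landsberg–Ottaviani 2015: `bR(⟨n,n,n⟩) ≥ 2n² − n`** (Landsberg 2017, Thm. 2.5.2.6 [LO15]:
"`R̲(M_⟨m,n,l⟩) ≥ nl(n+m−1)/m` for `n ≤ m`; in particular `R̲(M_⟨n⟩) ≥ 2n² − n`"), here for the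
algebraic border rank over every field of characteristic `0`, in the form `(2n − 1)·n ≤ bR(⟨n,n,n⟩)`:
from the previous minor, `C(2n−1,n)·n² ≤ rank K_Φ(⟨n,n,n⟩) ≤ C(2n−2,n−1)·bR(⟨n,n,n⟩)`
(`LandsbergOttaviani2015_thm21_algBorderRank`) and `C(2n−1,n)·n = (2n−1)·C(2n−2,n−1)`.
[cite: Landsberg2017, §2.5.2, Thm. 2.5.2.6] [cite: LandsbergOttaviani2015, Thm 2.1 and §3] -/
theorem LandsbergOttaviani2015_algBorderRank_matMulTensor (n : ℕ) (hn : 1 ≤ n) :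
    (2 * n - 1) * n ≤ algBorderRank (matMulTensor K n n n) := by
  obtain ⟨p, rfl⟩ : ∃ p, n = p + 1 := ⟨n - 1, by omega⟩
  have h1 := le_rank_koszulFlattening_vandermondeProj_matMulTensor K p
  have h2 := LandsbergOttaviani2015_thm21_algBorderRank p (vandermondeProj K p)
    (matMulTensor K (p + 1) (p + 1) (p + 1))
  have h12 := h1.trans h2
  -- `C(2p+1, p+1) (p+1) = (2p+1) C(2p, p)`
  have hid : (2 * p + 1).choose (p + 1) * (p + 1) = (2 * p + 1) * (2 * p).choose p :=
    (Nat.add_one_mul_choose_eq (2 * p) p).symm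
  have hpos : 0 < (2 * p).choose p := Nat.choose_pos (by omega)
  have h3 : (2 * p).choose p * ((2 * p + 1) * (p + 1)) ≤
      (2 * p).choose p * algBorderRank (matMulTensor K (p + 1) (p + 1) (p + 1)) := by
    calc (2 * p).choose p * ((2 * p + 1) * (p + 1))
        = (2 * p + 1).choose (p + 1) * (p + 1) * (p + 1) := by rw [hid]; ring
      _ ≤ _ := h12
  have h4 := Nat.le_of_mul_le_mul_left h3 hpos
  calc (2 * (p + 1) - 1) * (p + 1) = (2 * p + 1) * (p + 1) := by
        rw [show 2 * (p + 1) - 1 = 2 * p + 1 by omega]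
    _ ≤ _ := h4

/-- `bR(⟨4,4,4⟩) ≥ 28` in characteristic `0` (Landsberg–Ottaviani: `2·16 − 4`).
[cite: Landsberg2017, §2.5.2, Thm. 2.5.2.6] -/
theorem twentyeight_le_algBorderRank_matMulTensor_four : 28 ≤ algBorderRank (matMulTensor K 4 4 4) := by
  have := LandsbergOttaviani2015_algBorderRank_matMulTensor K 4 (by norm_num)
  omega

/-- `bR(⟨3,3,3⟩) ≥ 15` in characteristic `0` (Landsberg–Ottaviani: `2·9 − 3`).
[cite: Landsberg2017, §2.5.2, Thm. 2.5.2.6] -/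
theorem fifteen_le_algBorderRank_matMulTensor_three : 15 ≤ algBorderRank (matMulTensor K 3 3 3) := by
  have := LandsbergOttaviani2015_algBorderRank_matMulTensor K 3 (by norm_num)
  omega

end LandsbergOttaviani

/-! ## Numerics: `8^{ω/3} < 6` and `27^{ω/3} < 14` from `ω < 2.39` -/

section Numerics

variable (K : Type u) [Field K]

/-- `8^{ω/3} < 6`: `ω < 2.39 < 12/5` (`BCS1997_cor1545_field`, the laser method on `CW_6`, proved in
the tree) and `(8^{4/5})⁵ = 4096 < 7776 = 6⁵`. [cite: BurgisserClausenShokrollahi1997, Cor. 15.45] -/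
theorem eight_rpow_omega_div_three_lt_six : (8 : ℝ) ^ (omega K / 3) < 6 := by
  have hω : omega K < 2.39 := BCS1997_cor1545_field K
  have h1 : omega K / 3 < (4 : ℝ) / 5 := by linarith
  have h2 : (8 : ℝ) ^ (omega K / 3) < (8 : ℝ) ^ ((4 : ℝ) / 5) :=
    Real.rpow_lt_rpow_of_exponent_lt (by norm_num) h1
  have h3 : ((8 : ℝ) ^ ((4 : ℝ) / 5)) ^ 5 < (6 : ℝ) ^ 5 := by
    rw [← Real.rpow_natCast ((8 : ℝ) ^ ((4 : ℝ) / 5)) 5, ← Real.rpow_mul (by norm_num)]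
    norm_num
  have h4 : (8 : ℝ) ^ ((4 : ℝ) / 5) < 6 := lt_of_pow_lt_pow_left₀ 5 (by norm_num) h3
  exact h2.trans h4

/-- `27^{ω/3} < 14`: `ω < 2.39 < 12/5` and `(27^{4/5})⁵ = 531441 < 537824 = 14⁵`.
[cite: BurgisserClausenShokrollahi1997, Cor. 15.45] -/
theorem twentyseven_rpow_omega_div_three_lt_fourteen : (27 : ℝ) ^ (omega K / 3) < 14 := by
  have hω : omega K < 2.39 := BCS1997_cor1545_field K
  have h1 : omega K / 3 < (4 : ℝ) / 5 := by linarith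
  have h2 : (27 : ℝ) ^ (omega K / 3) < (27 : ℝ) ^ ((4 : ℝ) / 5) :=
    Real.rpow_lt_rpow_of_exponent_lt (by norm_num) h1
  have h3 : ((27 : ℝ) ^ ((4 : ℝ) / 5)) ^ 5 < (14 : ℝ) ^ 5 := by
    rw [← Real.rpow_natCast ((27 : ℝ) ^ ((4 : ℝ) / 5)) 5, ← Real.rpow_mul (by norm_num)]
    norm_num
  have h4 : (27 : ℝ) ^ ((4 : ℝ) / 5) < 14 := lt_of_pow_lt_pow_left₀ 5 (by norm_num) h3
  exact h2.trans h4

/-- `64^{ω/3} < 27`: `ω < 2.373 < 19/8` (`LeGall2014_cw4`, the laser method on `CW_q^{⊗4}`, proved in the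
tree) and `(64^{19/24})^{24} = 64^{19} = 2^{114} < 27^{24} = 3^{72}`. [cite: LeGall2014, §6.3 and Table 3] -/
theorem sixtyfour_rpow_omega_div_three_lt_twentyseven : (64 : ℝ) ^ (omega K / 3) < 27 := by
  have hω : omega K < 2.373 := LeGall2014_cw4 K
  have h1 : omega K / 3 < (19 : ℝ) / 24 := by linarith
  have h2 : (64 : ℝ) ^ (omega K / 3) < (64 : ℝ) ^ ((19 : ℝ) / 24) :=
    Real.rpow_lt_rpow_of_exponent_lt (by norm_num) h1
  have h3 : ((64 : ℝ) ^ ((19 : ℝ) / 24)) ^ 24 < (27 : ℝ) ^ 24 := by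
    rw [← Real.rpow_natCast ((64 : ℝ) ^ ((19 : ℝ) / 24)) 24, ← Real.rpow_mul (by norm_num)]
    norm_num
  have h4 : (64 : ℝ) ^ ((19 : ℝ) / 24) < 27 := lt_of_pow_lt_pow_left₀ 24 (by norm_num) h3
  exact h2.trans h4

end Numerics

/-! ## The two smallest cubic instances of the Coppersmith–Winograd barrier, for the BORDER rank -/

section Strict

variable (K : Type u) [Field K] [CharZero K]

/-- **`2^ω < bR(⟨2,2,2⟩)` in characteristic `0`** — the `⟨2,2,2⟩` instance of the border-rank strict
asymptotic sum inequality (`(2·2·2)^{ω/3} < bR(⟨2,2,2⟩)`; Coppersmith–Winograd 1982 as reported in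
BCS 1997, §15.13 Notes, p. 455), PROVED here numerically: `8^{ω/3} < 6 ≤ bR(⟨2,2,2⟩)`
(`ω < 2.39`, BCS Cor. 15.45, and BCS Cor. (19.14)). In particular no approximate bilinear algorithm for
`2 × 2` matrices certifies its own exponent through Bini's inequality (`ω ≤ log₂ bR(⟨2,2,2⟩)` is strict).
[cite: BurgisserClausenShokrollahi1997, §15.13 Notes (p. 455) and Cor. (19.14) (p. 515)] -/
theorem rpow_omega_div_three_lt_algBorderRank_matMulTensor_two :
    ((2 * 2 * 2 : ℕ) : ℝ) ^ (omega K / 3) < algBorderRank (matMulTensor K 2 2 2) := by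
  have h6 : (6 : ℝ) ≤ algBorderRank (matMulTensor K 2 2 2) := by
    exact_mod_cast six_le_algBorderRank_matMulTensor_two K
  have h8 : ((2 * 2 * 2 : ℕ) : ℝ) = 8 := by norm_num
  rw [h8]
  exact (eight_rpow_omega_div_three_lt_six K).trans_le h6

/-- **`3^ω < bR(⟨3,3,3⟩)` in characteristic `0`** — the `⟨3,3,3⟩` instance of the border-rank strict
asymptotic sum inequality, numerically: `27^{ω/3} < 14 ≤ bR(⟨3,3,3⟩)` (`ω < 2.39` and BCS Cor. (19.14)).
[cite: BurgisserClausenShokrollahi1997, §15.13 Notes (p. 455) and Cor. (19.14) (p. 515)] -/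
theorem rpow_omega_div_three_lt_algBorderRank_matMulTensor_three :
    ((3 * 3 * 3 : ℕ) : ℝ) ^ (omega K / 3) < algBorderRank (matMulTensor K 3 3 3) := by
  have h14 : (14 : ℝ) ≤ algBorderRank (matMulTensor K 3 3 3) := by
    exact_mod_cast fourteen_le_algBorderRank_matMulTensor_three K
  have h27 : ((3 * 3 * 3 : ℕ) : ℝ) = 27 := by norm_num
  rw [h27]
  exact (twentyseven_rpow_omega_div_three_lt_fourteen K).trans_le h14

/-- **`4^ω < bR(⟨4,4,4⟩)` in characteristic `0`** — the `⟨4,4,4⟩` instance of the border-rank strict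
asymptotic sum inequality, numerically: `64^{ω/3} < 27 < 28 ≤ bR(⟨4,4,4⟩)` (Le Gall's `ω < 2.373` and
Landsberg–Ottaviani's `2n² − n`). This is where the numerical route ends: for `n ≥ 5` the known lower
bounds on `bR(⟨n,n,n⟩)` are below `n^{2.373}`.
[cite: BurgisserClausenShokrollahi1997, §15.13 Notes (p. 455)] [cite: Landsberg2017, §2.5.2, Thm. 2.5.2.6] -/
theorem rpow_omega_div_three_lt_algBorderRank_matMulTensor_four :
    ((4 * 4 * 4 : ℕ) : ℝ) ^ (omega K / 3) < algBorderRank (matMulTensor K 4 4 4) := by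
  have h28 : (28 : ℝ) ≤ algBorderRank (matMulTensor K 4 4 4) := by
    exact_mod_cast twentyeight_le_algBorderRank_matMulTensor_four K
  have h64 : ((4 * 4 * 4 : ℕ) : ℝ) = 64 := by norm_num
  rw [h64]
  linarith [sixtyfour_rpow_omega_div_three_lt_twentyseven K]

end Strict

end Literature.Computability.AlgebraicComplexity

end
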